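import Summits.QuantumFields.BalabanUV.Beta.FP.NestedDoorSocketTowerGB
import Summits.QuantumFields.BalabanUV.Beta.FP.NestedStepLawTorusCompositeOneShotTopSymB

/-!
# BOUNDED-LEVELS TWIN `NestedDoorSocketTowerSymB` (R-FP-76, the repair of E-FP-34-1, journal l.64955): the statements and proofs of `NestedDoorSocketTowerSym` VERBATIM but for the displayed
# clause `hlev : ∀ i, i ≤ n → lev i = lev (i + 1) + 1` (the original `∀ i, lev i = lev (i + 1) + 1` is unsatisfiable for `lev : ℕ → ℕ`, so the original theorem is
# vacuous — kernel-proved, `HOME/b2b-balaban-beta-d1-p3/g34/hlev/HlevVacuous.lean`) and the `B` suppliers; helper lemmas without `hlev` are imported from the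
# original, not re-declared.  Generator `HOME/b2b-balaban-beta-d1-p3/g34/recut/recutB.py` over the TREE bytes.  Road «FP» OWNER d1-p3 gen 34, 2026-08-25.  ORIGINAL HEADER:
# `BalabanUV.Beta.FP.NestedDoorSocketTowerSym` — road «FP» for binder row D1, ROUTE T under RULING R-D1-g52-1 (β1) ∕ R-FP-70 ∕ R-FP-71: **THE (0.4)-SYMMETRISED
# TOWER's DOOR** — #41c-G `NestedDoorSocketTowerG.hessT_kernel_law_tower_G` (#21-G BY TERM per direction through the socket #41a) AT `Q := QSym Lc`,
# `K ℓ _ := bhKStepSh d Lc (Dsh Lc) ℓ`, roots `fun _ => ctrOff (d+1) Lc`; the brick inputs `hH₀t hone hId htop a0` DISCHARGED, everything else DISPLAYED at the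
# sym spellings (the second of the road's four «generator passes» on the sym column: SPEC #41 STEPS 1+2 at the re-based tower's door)

WHAT.  ONE `exact`: #41c-G at the sym objects, exactly as (6) `NestedStepLawTorusCompositeOneShotTopSym` instantiates #21-G — pins `hH₀` (the field block of an1's
shifted straight spread periodised on the tower torus), `hQ₁₀ : Q₁₀ = compRowsSym Lc M′ lev (fun _ => ctrOff) (n+1)` (leaf-06 G-0 §3), `hτ₁` (the one-shot big comb
one level down), `hτ₂` (the top comb at `ctrOff`), `hQ₂₀` (the top step's sym rows in (B)'s slot presentation `pμ′ mμ′` with `hfμ′ hcoarse′`); DISCHARGED INSIDE: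
`H₀ᵀ = H₀` (`RelInvPeriodisedCombTorusLetters.torus_H₀_transpose_comb`), leaf-05's one-step letters (`torus_h1_comb ∕ hId_comb`), the top comb-KKT
(`RelInvPeriodisedCombRecord.torus_isUnit_det_kkt_combRows_comb`), `a0` (the rooted `torus_a0_tower` through (6) §0 `bhKStepSh_Dsh_inl_inl_eq_bhKStepAt`);
DISPLAYED (R-FP-71 «display what you use», the sym shapes of (6) v1.2): `hSL` (leaf-06 G-1 §3 `det_nestedSliceSym_mul_towerGen_ne_zero` discharges it), `c0`
(leaf-02 R-20 `compRowsSym_mul_towerGen_succ` at `m := n`), `hTW` (leaf-06 G-2 §2), `d0` (R-20 `QtopSym_mul_smul_tgrad_res`), and #41c's direction module ∕ jets as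
functions ∕ namings ∕ rows `uTop hH₁t hH₂t a1 a2 c1 c2 d1 d2 ∀ v` ∕ the three right inverses `XN XF XG` — HYPOTHESES for the row's (C1) suppliers.  CONCLUSION:
#41c-G's, at the sym index types (`NParam Lc M′ (fun _ => ctrOff) (n+1)`, `Res (toSite (ctrOff (d+1) Lc)) Lc M′`).  Consumers: #41d-Sym (the (S3-1) legs at the sym
charts — leaf-05's sym comb leg, the row's sym one-shot charts), then #42a-Sym and the OWNER's `TowerKernelLawNamed` (design (A), after an2's F6d SPEC final).
[folklore] ONE instantiation BY NAME; no `def`, no `def … : Prop`, nothing cited, 0 sorry.  Rows, legs and namings are HYPOTHESES; nothing of the dictionary ∕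
Bałaban's asserted (the presentation is the row's (β1) ruling, quoted).  No existing file touched.

HONEST DEPENDENCY (page 1, mandatory): continuum YM on T⁴ ⇐ BetaPertH ∧ nine spine estimates (0/9 proved); BetaPertH ⇐ (D1) ∧ (D4) ∧ CAP+tail;
G-an2-4 gates asym, D1 and NE2/3/4.  HONEST FRAMING (cell contract, verbatim): «discharging `BetaPertH` makes Bałaban's UV stability UNCONDITIONAL —
a real constructive-QFT result; it is NOT the continuum limit and NOT the Clay problem.»  ABSOLUTE RULE (cell charter, verbatim): «No internally-minted
statement may enter as a cited fact. Every hypothesis is either kernel-proved in this package or a verbatim quotation of a PUBLISHED theorem with page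
reference. The manuscript(s) under audit are NOT citable for their own disputed steps — they are the thing under adjudication; programme-internal
(2001/route/tribunal) claims are never citable.»  0 estimates; 0∕4 row-D1 binders (hW, hR, D1Tel, D1Rep); ROOT M‴ p325680 untouched; NOT (C1), NOT (L2′),
NOT (T-ID), NOT SDF, NOT D1, NOT BetaPertH, NOT continuum, NOT Clay.  Road «FP» OWNER, b2b-balaban-beta-d1-p3 gen 31, 2026-08-24.  No existing file touched.
-/

noncomputable section

namespace Summit.QuantumFields.BalabanUV.Beta.FP.NestedDoorSocketTowerSymB

open scoped BigOperators Matrix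
open Matrix Finset
open Literature.Probability.LatticeModels (Torus.proj)
open Literature.MathematicalPhysics.QuantumFieldTheory.Balaban1983to89
open Literature.MathematicalPhysics.QuantumFieldTheory.Balaban1983to89.Beta
open Literature.MathematicalPhysics.QuantumFieldTheory.Balaban1983to89.Beta.Composition (kkt)
open Literature.MathematicalPhysics.QuantumFieldTheory.Balaban1983to89.Beta.CompositionSingular (effForm flucCov minOp minOpL)
open B5Prop11Plancherel (fine)
open B6Lemma24Torus (pbox mem_pbox)
open AffineAveraging (Site box toSite unitVec)
open OneStepResolventKernel (Fib)
open Summit.QuantumFields.BalabanUV.Beta.BorderedHessian (bhKStepAt stepScale)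
open Summit.QuantumFields.BalabanUV.Beta.D1BFx.LogDetSecondVariation (secondVar)
open Summit.QuantumFields.BalabanUV.Beta.FP.SecondVarPolarisation (mixedVar)
open Summit.QuantumFields.BalabanUV.Beta.D1BFx.MixedVarPackedHess (hessT)
open Summit.QuantumFields.BalabanUV.Beta.FP.KernelPeriodisationFib (Idx perF)
open Summit.QuantumFields.BalabanUV.Beta.FP.TorusCombRows (Res)
open Summit.QuantumFields.BalabanUV.Beta.FP.TorusCompositeObjects (towerTorus compRows NParam combF bigP towerGen)
open Summit.QuantumFields.BalabanUV.Beta.FP.TorusCompositeFP (evalN)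
open Summit.QuantumFields.BalabanUV.Beta.FP.TorusGaugeCovariance (tgrad)
open Summit.QuantumFields.BalabanUV.Beta.GAN24.FineReadoutCauchyFrame (toSite_mem_range)
open Summit.QuantumFields.BalabanUV.Beta.FP.DirectionalJetShapes (lin_negDiagonal_comp)
open Summit.QuantumFields.BalabanUV.Beta.FP.LevelZeroDoorShapes (hessT_law_of_mixedVar_law)
open Summit.QuantumFields.BalabanUV.Beta.FP.NestedDoorSocket (mixedVar_kernel_law_of_nested_door)
open Summit.QuantumFields.BalabanUV.Beta.FP.NestedStepLawTorusCompositeOneShotTop (secondVar_oneShot_nestedStepLaw_torus_composite_graded_oneShot_of_uTop)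
open Summit.QuantumFields.BalabanUV.Beta.FP.TorusCompositeObjectsG (StepRows compRowsG nestedSliceG)
open Summit.QuantumFields.BalabanUV.Beta.FP.NestedStepLawTorusCompositeOneShotTopGB (secondVar_oneShot_nestedStepLaw_torus_composite_graded_oneShot_of_uTop_G)
open ExpKernelCalculus (MKer)
open BalabanStepJetsSucc (wVH)
open Matrix
open AffineAveraging (Site box toSite)
open Summit.QuantumFields.BalabanUV.Beta.BorderedHessian (bhKStepAt)
open Summit.QuantumFields.BalabanUV.Beta.AxialDressingRooted (IsCombBondAt)
open Summit.QuantumFields.BalabanUV.Beta.FP.KernelPeriodisationFib (Idx perF perF_apply perZ perZ_apply trF perF_transpose)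
open Summit.QuantumFields.BalabanUV.Beta.FP.CompositeWardLetters (compWard_b0 compWard_b1 compWard_b2)
open Summit.QuantumFields.BalabanUV.Beta.FP.NestedStepLawTransported (secondVar_nestedFP_eq_zero)
open Summit.QuantumFields.BalabanUV.Beta.FP.NestedStepLawTransportedExpGraded (secondVar_oneShot_nestedStepLaw_expTransported_graded_of_uni)
open Summit.QuantumFields.BalabanUV.Beta.FP.TorusCompositeObjects (towerTorus towerTorus_apply compRows nestedSlice NParam Qstep combF bigP towerGen
  towerGen_succ bigRoot bigRatio bigRatio_pos bigRatio_eq_pow pboxCongr pboxCongr_coe)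
open Summit.QuantumFields.BalabanUV.Beta.FP.TorusCompositeUnimodular (det_bigP_mul_towerGen_ne_zero)
open Summit.QuantumFields.BalabanUV.Beta.FP.TorusCompositeFP (evalN torus_uP_exp_tower)
open Summit.QuantumFields.BalabanUV.Beta.FP.TorusCompositeIntertwining (towerC₁ torus_j1_tower torus_j2_tower)
open Summit.QuantumFields.BalabanUV.Beta.FP.TorusGeneratorIntertwining (torus_uC_exp)
open Summit.QuantumFields.BalabanUV.Beta.FP.NestedStepLawTorusComposite (H₀_transpose_of_dvd dvd_towerTorus_succ)
open AffineAveraging (unitVec)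
open Summit.QuantumFields.BalabanUV.Beta.FP.TorusEffFormComposite (torus_composite_inv_and_eff)
open Summit.QuantumFields.BalabanUV.Beta.FP.RelInvPeriodisedCoarse (det_kkt_smul_form_ne_zero_iff)
open Summit.QuantumFields.BalabanUV.Beta.FP.RelInvPeriodisedCombRows (torus_isUnit_det_kkt_combRows)
open Summit.QuantumFields.BalabanUV.Beta.FP.RelInvPeriodisedEffFormCoarse (wVH_pos)
open Summit.QuantumFields.BalabanUV.Beta.FP.NestedStepLawTorusInstance (dvd_fine)
open Summit.QuantumFields.BalabanUV.Beta.FP.TorusCompositeSlice (det_nestedSlice_mul_towerGen_ne_zero torus_t1_tower_of_c1 torus_t2_tower_of_c2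
  det_combF_mul_smul_tgrad_res_ne_zero prod_stepScale_mul_card_ne_zero)
open Summit.QuantumFields.BalabanUV.Beta.FP.NestedFPSplit (secondVar_nestedFP_eq_zero_of_blocks)
open Summit.QuantumFields.BalabanUV.Beta.FP.TorusCompositeCovariance (compRows_mul_towerGen_succ Qtop_mul_smul_tgrad_res)
open Summit.QuantumFields.BalabanUV.Beta.FP.PeriodisedWardOrderZero (sum_perZ_bhKStepAt_ff_mul_tgrad sum_perZ_bhKStepAt_ff_mul_grad_periodic abs_tdelta_le)
open Summit.QuantumFields.BalabanUV.Beta.FP.TorusGaugeCovariance (tdelta)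
open Summit.QuantumFields.BalabanUV.Beta.FP.TorusGaugeCovarianceCoarse (tgradBlock tgradBlock_inl tdelta_quo_congr)
open Summit.QuantumFields.BalabanUV.Beta.BorderedHessian (stepScale)
open Literature.MathematicalPhysics.QuantumFieldTheory.LatticeForm (quo)
open Literature.MathematicalPhysics.QuantumFieldTheory.Balaban1983to89.B4TorusKernel.MultiPeriod (translate_apply)
open Summit.QuantumFields.BalabanUV.Beta.FP.TorusCompositeSliceOneShot (torus_hTW_oneShot_tower torus_uLow_oneShot_tower)
open Literature.MathematicalPhysics.QuantumFieldTheory.Balaban1983to89.Beta.GaugeFixingPropagators (isUnit_det_kkt_sliceChange₃ blocks_sliceChange₃)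
open Finset
open Summit.QuantumFields.BalabanUV.Beta.FP.NestedStepLawTorusCompositeOneShot (torus_a0_tower)
open Summit.QuantumFields.BalabanUV.Beta.FP.TorusCompositeObjectsG (StepRows compRowsG nestedSliceG QstepSym QSym compRowsSym nestedSliceSym)
open Summit.QuantumFields.BalabanUV.Beta.SymShiftedSpread (bhKStepSh bhKStepSh_apply)
open Summit.QuantumFields.BalabanUV.Beta.BorderedHessian (bhKStep bhKStep_zero bhKStepAt_zero bhKAt bhKAt_inl_inl)
open Summit.QuantumFields.BalabanUV.Beta.DshAn1 (Dsh Dsh_inl_inl)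
open Summit.QuantumFields.BalabanUV.Beta.FP.RelInvPeriodisedCombTorusLetters (torus_h1_comb hId_comb torus_H₀_transpose_comb)
open Summit.QuantumFields.BalabanUV.Beta.FP.RelInvPeriodisedCombRecord (torus_isUnit_det_kkt_combRows_comb)
open AveragingContoursRooted (ctrOff ctrOff_mem_box)
open Summit.QuantumFields.BalabanUV.Beta.FP.NestedDoorSocketTowerGB (hessT_kernel_law_tower_G)
open Summit.QuantumFields.BalabanUV.Beta.FP.NestedStepLawTorusCompositeOneShotTopSym (bhKStepSh_Dsh_inl_inl_eq_bhKStepAt)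
variable {d : ℕ}

section TowerSym

variable (M' : Fin (d + 1) → ℕ) [∀ μ, NeZero (M' μ)] (Lc : ℕ) [NeZero Lc] (lev : ℕ → ℕ) (n : ℕ)

/-- [folklore] **THE SYM TOWER's DOOR**: #41c-G `hessT_kernel_law_tower_G` at `Q := QSym Lc`, `K ℓ _ := bhKStepSh d Lc (Dsh Lc) ℓ`, roots `ctrOff (d+1) Lc`;
`hH₀t hone hId htop a0` discharged inside ((6)'s dischargers by name), `hSL c0 hTW d0` and #41c's direction rows ∕ legs displayed. -/
theorem hessT_kernel_law_tower_sym (hrs : ∀ _k : ℕ, ctrOff (d + 1) Lc ∈ box (d + 1) Lc) (hlev : ∀ i, i ≤ n → lev i = lev (i + 1) + 1)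
    (hM' : ∀ i, Lc ∣ M' i)
    -- the coarse multipliers' slot presentation one level above `M′` (as (B): injective, `inr`-valued, exactly the `Lc`-coarse sites of `M′`)
    {κ : Type*} [Fintype κ] [DecidableEq κ] (pμ' : κ → ↥(pbox M')) (mμ' : κ → Fin (d + 1))
    (hfμ' : Function.Injective (fun a : κ => ((pμ' a, Sum.inr (mμ' a)) : Idx M' (Fib d))))
    (hcoarse' : ∀ (s : ↥(pbox M')) (m : Fin (d + 1)),
      ((s, Sum.inr m) : Idx M' (Fib d)) ∈ Set.range (fun a : κ => ((pμ' a, Sum.inr (mμ' a)) : Idx M' (Fib d))) ↔ Torus.proj Lc (s : Site (d + 1)) = 0)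
    -- the (0.4)-SYMMETRISED composite objects PINNED (leaf-06 `TorusCompositeObjectsG` §3), roots `ctrOff (d+1) Lc` at every storey
    {H₀ : Matrix (↥(pbox (towerTorus Lc M' (n + 1))) × Fin (d + 1)) (↥(pbox (towerTorus Lc M' (n + 1))) × Fin (d + 1)) ℝ}
    {Q₁₀ : Matrix (↥(pbox M') × Fin (d + 1)) (↥(pbox (towerTorus Lc M' (n + 1))) × Fin (d + 1)) ℝ}
    {τ₁ : Matrix (NParam Lc (fine Lc M') (fun k => (fun _ : ℕ => ctrOff (d + 1) Lc) (k + 1)) n) (↥(pbox (towerTorus Lc M' (n + 1))) × Fin (d + 1)) ℝ}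
    (hH₀ : H₀ = (perF (towerTorus Lc M' (n + 1)) (bhKStepSh d Lc (Dsh Lc) (lev (n + 1)))).submatrix
        (fun b : (↥(pbox (towerTorus Lc M' (n + 1))) × Fin (d + 1)) => ((b.1, Sum.inl b.2) : Idx (towerTorus Lc M' (n + 1)) (Fib d)))
        (fun b : (↥(pbox (towerTorus Lc M' (n + 1))) × Fin (d + 1)) => ((b.1, Sum.inl b.2) : Idx (towerTorus Lc M' (n + 1)) (Fib d))))
    (hQ₁₀ : Q₁₀ = compRowsSym Lc M' lev (fun _ : ℕ => ctrOff (d + 1) Lc) (n + 1))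
    (hτ₁ : τ₁ = bigP Lc (fine Lc M') (fun k => (fun _ : ℕ => ctrOff (d + 1) Lc) (k + 1)) (fun k => toSite_mem_range (hrs (k + 1))) n)
    -- (SLICE-m) OF THE TOWER BELOW `M′`, DISPLAYED (R-FP-71 «display what you use»): its NESTED comb slice is transversal to its generators
    -- (rooted: leaf-06 `TorusCompositeSlice.det_nestedSlice_mul_towerGen_ne_zero`; sym: leaf-06's G-1 sym theorem at the constant root list, fed leaf-02's R-20)
    (hSL : (nestedSliceSym Lc (fine Lc M') (fun k => lev (k + 1)) (fun k => (fun _ : ℕ => ctrOff (d + 1) Lc) (k + 1)) n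
        * towerGen Lc (fine Lc M') (fun k => (fun _ : ℕ => ctrOff (d + 1) Lc) (k + 1)) n).det ≠ 0)
    {τ₂ : Matrix (Res (toSite (ctrOff (d + 1) Lc)) Lc M') (↥(pbox M') × Fin (d + 1)) ℝ} (hτ₂ : τ₂ = combF Lc M' ((fun _ : ℕ => ctrOff (d + 1) Lc) 0))
    -- the top step's (0.4)-symmetrised averaging rows (level `lev 0`), PINNED in (B)'s slot presentation; its comb-KKT `htop` discharged inside
    {Q₂₀ : Matrix κ (↥(pbox M') × Fin (d + 1)) ℝ}
    (hQ₂₀ : Q₂₀ = (perF M' (bhKStepSh d Lc (Dsh Lc) (lev 0))).submatrix (fun a : κ => ((pμ' a, Sum.inr (mμ' a)) : Idx M' (Fib d)))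
        (fun b : ↥(pbox M') × Fin (d + 1) => ((b.1, Sum.inl b.2) : Idx M' (Fib d))))
    {W₀ : Matrix (↥(pbox (towerTorus Lc M' (n + 1))) × Fin (d + 1)) (NParam Lc M' (fun _ : ℕ => ctrOff (d + 1) Lc) (n + 1)) ℝ} (hW₀ : W₀ = towerGen Lc M' (fun _ : ℕ => ctrOff (d + 1) Lc) (n + 1))
    {P : Matrix (NParam Lc M' (fun _ : ℕ => ctrOff (d + 1) Lc) (n + 1)) (↥(pbox (towerTorus Lc M' (n + 1))) × Fin (d + 1)) ℝ} (hP : P = bigP Lc M' (fun _ : ℕ => ctrOff (d + 1) Lc) (fun k => toSite_mem_range (hrs k)) (n + 1))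
    -- the step constant of the chart transport (#21's `c`), the (COV-m) order-0 image PINNED, the one-shot resolvent words and `𝔔₀` NAMED (#21 VERBATIM)
    (c : ℝ)
    {Dbar : Matrix (↥(pbox M') × Fin (d + 1)) (Res (toSite (ctrOff (d + 1) Lc)) Lc M') ℝ}
    (hDbar : Dbar = (∏ i ∈ range (n + 1), (stepScale d Lc (lev (i + 1)) * ((box (d + 1) Lc).card : ℝ))) •
        (tgrad M').submatrix (fun a : (↥(pbox M') × Fin (d + 1)) => ((a.1, Sum.inl a.2) : Idx M' (Fib d))) (fun t : (Res (toSite (ctrOff (d + 1) Lc)) Lc M') => (t.1 : ↥(pbox M'))))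
    -- (COV-m) ORDER 0 AT THE TOP DEPTH in the pinned letters and the ONE-SHOT slice's transversality, DISPLAYED (R-FP-71 «display what you use»;
    -- rooted: leaf-02 `compRows_mul_towerGen_succ` ∕ leaf-06 `torus_hTW_oneShot_tower`; sym: leaf-02's R-20 at the constant root list ∕ leaf-06 G-2 §2)
    (c0 : Q₁₀ * W₀ = fromCols Dbar (0 : Matrix (↥(pbox M') × Fin (d + 1)) (NParam Lc (fine Lc M') (fun k => (fun _ : ℕ => ctrOff (d + 1) Lc) (k + 1)) n) ℝ))
    (hTW : (Matrix.fromRows (τ₂ * Q₁₀) τ₁ * W₀).det ≠ 0)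
    {Γ : Matrix (↥(pbox (towerTorus Lc M' (n + 1))) × Fin (d + 1)) (↥(pbox (towerTorus Lc M' (n + 1))) × Fin (d + 1)) ℝ} {I : Matrix (↥(pbox (towerTorus Lc M' (n + 1))) × Fin (d + 1)) ((↥(pbox M') × Fin (d + 1)) ⊕ (NParam Lc (fine Lc M') (fun k => (fun _ : ℕ => ctrOff (d + 1) Lc) (k + 1)) n)) ℝ} {L : Matrix ((↥(pbox M') × Fin (d + 1)) ⊕ (NParam Lc (fine Lc M') (fun k => (fun _ : ℕ => ctrOff (d + 1) Lc) (k + 1)) n)) (↥(pbox (towerTorus Lc M' (n + 1))) × Fin (d + 1)) ℝ} {S : Matrix ((↥(pbox M') × Fin (d + 1)) ⊕ (NParam Lc (fine Lc M') (fun k => (fun _ : ℕ => ctrOff (d + 1) Lc) (k + 1)) n)) ((↥(pbox M') × Fin (d + 1)) ⊕ (NParam Lc (fine Lc M') (fun k => (fun _ : ℕ => ctrOff (d + 1) Lc) (k + 1)) n)) ℝ}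
    (hΓ : flucCov H₀ (fromRows Q₁₀ τ₁) = Γ) (hI : minOp H₀ (fromRows Q₁₀ τ₁) = I) (hL : minOpL H₀ (fromRows Q₁₀ τ₁) = L) (hS : effForm H₀ (fromRows Q₁₀ τ₁) = S)
    {𝔔₀ : Matrix κ (↥(pbox (towerTorus Lc M' (n + 1))) × Fin (d + 1)) ℝ} (h𝔔₀ : Q₂₀ * Q₁₀ = 𝔔₀)
    -- the direction module and its DISPLAYED read-outs: finest-level direction `h := hv v` (enters only the rows and the generator jets — no linearity
    -- needed here: the jets' (bi)linearity is displayed; at the record it follows from `hv`'s), tree-gauge parameter `λ := lv v` and top generator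
    -- `X̄ := Xbf v` (LINEAR: they enter the one-shot namings `k1 k2 q1 q2`)
    {V : Type*} [AddCommGroup V] [Module ℝ V]
    (hv : V → ((↥(pbox (towerTorus Lc M' (n + 1))) × Fin (d + 1)) → ℝ)) (lv : V → (↥(pbox (towerTorus Lc M' (n + 1))) → ℝ))
    (hlv : ∀ (r : ℝ) (x y : V), lv (r • x + y) = r • lv x + lv y)
    (Xbf : V → Matrix κ κ ℝ) (hXbf : ∀ (r : ℝ) (x y : V), Xbf (r • x + y) = r • Xbf x + Xbf y)
    -- #21's displayed jets AS FUNCTIONS of the direction: first order linear, second order in two slots (linear in each; the door reads the diagonal)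
    (H₁f : V → Matrix (↥(pbox (towerTorus Lc M' (n + 1))) × Fin (d + 1)) (↥(pbox (towerTorus Lc M' (n + 1))) × Fin (d + 1)) ℝ) (hH₁l : ∀ (r : ℝ) (x y : V), H₁f (r • x + y) = r • H₁f x + H₁f y)
    (Q₁₁f : V → Matrix (↥(pbox M') × Fin (d + 1)) (↥(pbox (towerTorus Lc M' (n + 1))) × Fin (d + 1)) ℝ) (hQ₁₁l : ∀ (r : ℝ) (x y : V), Q₁₁f (r • x + y) = r • Q₁₁f x + Q₁₁f y)
    (Q₂₁f : V → Matrix κ (↥(pbox M') × Fin (d + 1)) ℝ) (hQ₂₁l : ∀ (r : ℝ) (x y : V), Q₂₁f (r • x + y) = r • Q₂₁f x + Q₂₁f y)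
    (H₂f : V → V → Matrix (↥(pbox (towerTorus Lc M' (n + 1))) × Fin (d + 1)) (↥(pbox (towerTorus Lc M' (n + 1))) × Fin (d + 1)) ℝ)
    (hH₂l : ∀ (r : ℝ) (x y z : V), H₂f (r • x + y) z = r • H₂f x z + H₂f y z) (hH₂r : ∀ (r : ℝ) (x y z : V), H₂f z (r • x + y) = r • H₂f z x + H₂f z y)
    (Q₁₂f : V → V → Matrix (↥(pbox M') × Fin (d + 1)) (↥(pbox (towerTorus Lc M' (n + 1))) × Fin (d + 1)) ℝ)
    (hQ₁₂l : ∀ (r : ℝ) (x y z : V), Q₁₂f (r • x + y) z = r • Q₁₂f x z + Q₁₂f y z) (hQ₁₂r : ∀ (r : ℝ) (x y z : V), Q₁₂f z (r • x + y) = r • Q₁₂f z x + Q₁₂f z y)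
    (Q₂₂f : V → V → Matrix κ (↥(pbox M') × Fin (d + 1)) ℝ)
    (hQ₂₂l : ∀ (r : ℝ) (x y z : V), Q₂₂f (r • x + y) z = r • Q₂₂f x z + Q₂₂f y z) (hQ₂₂r : ∀ (r : ℝ) (x y z : V), Q₂₂f z (r • x + y) = r • Q₂₂f z x + Q₂₂f z y)
    -- #21's composite and one-shot NAMINGS as functions (`h𝔔₁ h𝔔₂ k1 k2 q1 q2`; `X := −(c • diagonal (λ ∘ pr))` at `λ := lv v`; order 2 in two slots)
    (𝔔₁f : V → Matrix κ (↥(pbox (towerTorus Lc M' (n + 1))) × Fin (d + 1)) ℝ) (h𝔔₁ : ∀ v, Q₂₁f v * Q₁₀ + Q₂₀ * Q₁₁f v = 𝔔₁f v)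
    (𝔔₂f : V → V → Matrix κ (↥(pbox (towerTorus Lc M' (n + 1))) × Fin (d + 1)) ℝ)
    (h𝔔₂ : ∀ v v', Q₂₂f v v' * Q₁₀ + Q₂₁f v * Q₁₁f v' + (Q₂₁f v * Q₁₁f v' + Q₂₀ * Q₁₂f v v') = 𝔔₂f v v')
    (H'₁f : V → Matrix (↥(pbox (towerTorus Lc M' (n + 1))) × Fin (d + 1)) (↥(pbox (towerTorus Lc M' (n + 1))) × Fin (d + 1)) ℝ)
    (hH'₁f : ∀ v, H'₁f v = -((-(c • Matrix.diagonal (fun b : (↥(pbox (towerTorus Lc M' (n + 1))) × Fin (d + 1)) => lv v b.1)))ᵀ * H₀) + H₁f v + H₀ * (-(c • Matrix.diagonal (fun b : (↥(pbox (towerTorus Lc M' (n + 1))) × Fin (d + 1)) => lv v b.1))))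
    (H'₂f : V → V → Matrix (↥(pbox (towerTorus Lc M' (n + 1))) × Fin (d + 1)) (↥(pbox (towerTorus Lc M' (n + 1))) × Fin (d + 1)) ℝ)
    (hH'₂f : ∀ v v', H'₂f v v' = ((-(c • Matrix.diagonal (fun b : (↥(pbox (towerTorus Lc M' (n + 1))) × Fin (d + 1)) => lv v b.1))) * (-(c • Matrix.diagonal (fun b : (↥(pbox (towerTorus Lc M' (n + 1))) × Fin (d + 1)) => lv v' b.1))))ᵀ * H₀ + (-((-(c • Matrix.diagonal (fun b : (↥(pbox (towerTorus Lc M' (n + 1))) × Fin (d + 1)) => lv v b.1)))ᵀ * H₁f v') + -((-(c • Matrix.diagonal (fun b : (↥(pbox (towerTorus Lc M' (n + 1))) × Fin (d + 1)) => lv v b.1)))ᵀ * H₀ * (-(c • Matrix.diagonal (fun b : (↥(pbox (towerTorus Lc M' (n + 1))) × Fin (d + 1)) => lv v' b.1)))))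
      + ((-((-(c • Matrix.diagonal (fun b : (↥(pbox (towerTorus Lc M' (n + 1))) × Fin (d + 1)) => lv v b.1)))ᵀ * H₁f v') + -((-(c • Matrix.diagonal (fun b : (↥(pbox (towerTorus Lc M' (n + 1))) × Fin (d + 1)) => lv v b.1)))ᵀ * H₀ * (-(c • Matrix.diagonal (fun b : (↥(pbox (towerTorus Lc M' (n + 1))) × Fin (d + 1)) => lv v' b.1))))) + (H₂f v v' + H₁f v * (-(c • Matrix.diagonal (fun b : (↥(pbox (towerTorus Lc M' (n + 1))) × Fin (d + 1)) => lv v' b.1))) + (H₁f v * (-(c • Matrix.diagonal (fun b : (↥(pbox (towerTorus Lc M' (n + 1))) × Fin (d + 1)) => lv v' b.1))) + H₀ * ((-(c • Matrix.diagonal (fun b : (↥(pbox (towerTorus Lc M' (n + 1))) × Fin (d + 1)) => lv v b.1))) * (-(c • Matrix.diagonal (fun b : (↥(pbox (towerTorus Lc M' (n + 1))) × Fin (d + 1)) => lv v' b.1))))))))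
    (𝔔'₁f : V → Matrix κ (↥(pbox (towerTorus Lc M' (n + 1))) × Fin (d + 1)) ℝ) (h𝔔'₁f : ∀ v, 𝔔'₁f v = Xbf v * 𝔔₀ + 𝔔₁f v + 𝔔₀ * (-(c • Matrix.diagonal (fun b : (↥(pbox (towerTorus Lc M' (n + 1))) × Fin (d + 1)) => lv v b.1))))
    (𝔔'₂f : V → V → Matrix κ (↥(pbox (towerTorus Lc M' (n + 1))) × Fin (d + 1)) ℝ)
    (h𝔔'₂f : ∀ v v', 𝔔'₂f v v' = Xbf v * Xbf v' * 𝔔₀ + (Xbf v * 𝔔₁f v' + Xbf v * 𝔔₀ * (-(c • Matrix.diagonal (fun b : (↥(pbox (towerTorus Lc M' (n + 1))) × Fin (d + 1)) => lv v' b.1))))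
      + ((Xbf v * 𝔔₁f v' + Xbf v * 𝔔₀ * (-(c • Matrix.diagonal (fun b : (↥(pbox (towerTorus Lc M' (n + 1))) × Fin (d + 1)) => lv v' b.1)))) + (𝔔₂f v v' + 𝔔₁f v * (-(c • Matrix.diagonal (fun b : (↥(pbox (towerTorus Lc M' (n + 1))) × Fin (d + 1)) => lv v' b.1))) + (𝔔₁f v * (-(c • Matrix.diagonal (fun b : (↥(pbox (towerTorus Lc M' (n + 1))) × Fin (d + 1)) => lv v' b.1))) + 𝔔₀ * ((-(c • Matrix.diagonal (fun b : (↥(pbox (towerTorus Lc M' (n + 1))) × Fin (d + 1)) => lv v b.1))) * (-(c • Matrix.diagonal (fun b : (↥(pbox (towerTorus Lc M' (n + 1))) × Fin (d + 1)) => lv v' b.1))))))))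
    -- #21's generator jets by their closed forms at `h := hv v` (weight `h`), per direction
    (W₁f W₂f : V → Matrix (↥(pbox (towerTorus Lc M' (n + 1))) × Fin (d + 1)) (NParam Lc M' (fun _ : ℕ => ctrOff (d + 1) Lc) (n + 1)) ℝ)
    (hW₁f : ∀ v, W₁f v = Matrix.of fun (b : (↥(pbox (towerTorus Lc M' (n + 1))) × Fin (d + 1))) (e : (NParam Lc M' (fun _ : ℕ => ctrOff (d + 1) Lc) (n + 1))) => -(c * hv v b * evalN Lc M' (fun _ : ℕ => ctrOff (d + 1) Lc) (n + 1) (fun b' : (↥(pbox (towerTorus Lc M' (n + 1))) × Fin (d + 1)) => (b'.1 : Site (d + 1)) + unitVec b'.2) b e))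
    (hW₂f : ∀ v, W₂f v = Matrix.of fun (b : (↥(pbox (towerTorus Lc M' (n + 1))) × Fin (d + 1))) (e : (NParam Lc M' (fun _ : ℕ => ctrOff (d + 1) Lc) (n + 1))) => (c * hv v b) ^ 2 * evalN Lc M' (fun _ : ℕ => ctrOff (d + 1) Lc) (n + 1) (fun b' : (↥(pbox (towerTorus Lc M' (n + 1))) × Fin (d + 1)) => (b'.1 : Site (d + 1)) + unitVec b'.2) b e)
    -- the (COV-m) order-1∕2 images and the (WARD-m) sources, per direction (free)
    (Db₁f Db₂f : V → Matrix (↥(pbox M') × Fin (d + 1)) (Res (toSite (ctrOff (d + 1) Lc)) Lc M') ℝ) (Y₁f Y₂f : V → Matrix κ (NParam Lc M' (fun _ : ℕ => ctrOff (d + 1) Lc) (n + 1)) ℝ)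
    -- the `G`-side DRESSED WORDS, NAMED (#36b's shapes at `B := [Q₁₁f v; 0]`)
    (Gw₁f : V → Matrix (↥(pbox M') × Fin (d + 1)) (↥(pbox M') × Fin (d + 1)) ℝ)
    (hGw₁f : ∀ v, Gw₁f v = ((L * (H₁f v) - S * (fromRows (Q₁₁f v) (0 : Matrix (NParam Lc (fine Lc M') (fun k => (fun _ : ℕ => ctrOff (d + 1) Lc) (k + 1)) n) (↥(pbox (towerTorus Lc M' (n + 1))) × Fin (d + 1)) ℝ))) * I + L * (fromRows (Q₁₁f v) (0 : Matrix (NParam Lc (fine Lc M') (fun k => (fun _ : ℕ => ctrOff (d + 1) Lc) (k + 1)) n) (↥(pbox (towerTorus Lc M' (n + 1))) × Fin (d + 1)) ℝ))ᵀ * S).toBlocks₁₁)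
    (Gw₂f : V → V → Matrix (↥(pbox M') × Fin (d + 1)) (↥(pbox M') × Fin (d + 1)) ℝ)
    (hGw₂f : ∀ v v', Gw₂f v v' =
      ((((-((L * (H₁f v) - S * (fromRows (Q₁₁f v) (0 : Matrix (NParam Lc (fine Lc M') (fun k => (fun _ : ℕ => ctrOff (d + 1) Lc) (k + 1)) n) (↥(pbox (towerTorus Lc M' (n + 1))) × Fin (d + 1)) ℝ))) * Γ - L * (fromRows (Q₁₁f v) (0 : Matrix (NParam Lc (fine Lc M') (fun k => (fun _ : ℕ => ctrOff (d + 1) Lc) (k + 1)) n) (↥(pbox (towerTorus Lc M' (n + 1))) × Fin (d + 1)) ℝ))ᵀ * L) * (H₁f v') + L * (H₂f v v')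
          - (((L * (H₁f v) - S * (fromRows (Q₁₁f v) (0 : Matrix (NParam Lc (fine Lc M') (fun k => (fun _ : ℕ => ctrOff (d + 1) Lc) (k + 1)) n) (↥(pbox (towerTorus Lc M' (n + 1))) × Fin (d + 1)) ℝ))) * I + L * (fromRows (Q₁₁f v) (0 : Matrix (NParam Lc (fine Lc M') (fun k => (fun _ : ℕ => ctrOff (d + 1) Lc) (k + 1)) n) (↥(pbox (towerTorus Lc M' (n + 1))) × Fin (d + 1)) ℝ))ᵀ * S) * (fromRows (Q₁₁f v') (0 : Matrix (NParam Lc (fine Lc M') (fun k => (fun _ : ℕ => ctrOff (d + 1) Lc) (k + 1)) n) (↥(pbox (towerTorus Lc M' (n + 1))) × Fin (d + 1)) ℝ)) + S * (fromRows (Q₁₂f v v') (0 : Matrix (NParam Lc (fine Lc M') (fun k => (fun _ : ℕ => ctrOff (d + 1) Lc) (k + 1)) n) (↥(pbox (towerTorus Lc M' (n + 1))) × Fin (d + 1)) ℝ)))) * I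
        + (L * (H₁f v) - S * (fromRows (Q₁₁f v) (0 : Matrix (NParam Lc (fine Lc M') (fun k => (fun _ : ℕ => ctrOff (d + 1) Lc) (k + 1)) n) (↥(pbox (towerTorus Lc M' (n + 1))) × Fin (d + 1)) ℝ))) * (-((Γ * (H₁f v') + I * (fromRows (Q₁₁f v') (0 : Matrix (NParam Lc (fine Lc M') (fun k => (fun _ : ℕ => ctrOff (d + 1) Lc) (k + 1)) n) (↥(pbox (towerTorus Lc M' (n + 1))) × Fin (d + 1)) ℝ))) * I + Γ * (fromRows (Q₁₁f v') (0 : Matrix (NParam Lc (fine Lc M') (fun k => (fun _ : ℕ => ctrOff (d + 1) Lc) (k + 1)) n) (↥(pbox (towerTorus Lc M' (n + 1))) × Fin (d + 1)) ℝ))ᵀ * S)))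
      - ((-((L * (H₁f v) - S * (fromRows (Q₁₁f v) (0 : Matrix (NParam Lc (fine Lc M') (fun k => (fun _ : ℕ => ctrOff (d + 1) Lc) (k + 1)) n) (↥(pbox (towerTorus Lc M' (n + 1))) × Fin (d + 1)) ℝ))) * Γ - L * (fromRows (Q₁₁f v) (0 : Matrix (NParam Lc (fine Lc M') (fun k => (fun _ : ℕ => ctrOff (d + 1) Lc) (k + 1)) n) (↥(pbox (towerTorus Lc M' (n + 1))) × Fin (d + 1)) ℝ))ᵀ * L) * (-(fromRows (Q₁₁f v') (0 : Matrix (NParam Lc (fine Lc M') (fun k => (fun _ : ℕ => ctrOff (d + 1) Lc) (k + 1)) n) (↥(pbox (towerTorus Lc M' (n + 1))) × Fin (d + 1)) ℝ))ᵀ) + L * (fromRows (Q₁₂f v v') (0 : Matrix (NParam Lc (fine Lc M') (fun k => (fun _ : ℕ => ctrOff (d + 1) Lc) (k + 1)) n) (↥(pbox (towerTorus Lc M' (n + 1))) × Fin (d + 1)) ℝ))ᵀ) * S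
          + L * (-(fromRows (Q₁₁f v) (0 : Matrix (NParam Lc (fine Lc M') (fun k => (fun _ : ℕ => ctrOff (d + 1) Lc) (k + 1)) n) (↥(pbox (towerTorus Lc M' (n + 1))) × Fin (d + 1)) ℝ))ᵀ) * ((L * (H₁f v') - S * (fromRows (Q₁₁f v') (0 : Matrix (NParam Lc (fine Lc M') (fun k => (fun _ : ℕ => ctrOff (d + 1) Lc) (k + 1)) n) (↥(pbox (towerTorus Lc M' (n + 1))) × Fin (d + 1)) ℝ))) * I + L * (fromRows (Q₁₁f v') (0 : Matrix (NParam Lc (fine Lc M') (fun k => (fun _ : ℕ => ctrOff (d + 1) Lc) (k + 1)) n) (↥(pbox (towerTorus Lc M' (n + 1))) × Fin (d + 1)) ℝ))ᵀ * S)))).toBlocks₁₁)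
    -- #21's ROWS, FOR EVERY DIRECTION: the coarse chart's Faddeev–Popov 2-jet, the form parities, the graded Ward rows, (COV-m) orders 1, 2 on both levels
    (uTop : ∀ v, secondVar (τ₂ * Dbar) (τ₂ * Db₁f v) (τ₂ * Db₂f v) = 0)
    (hH₁t : ∀ v, (H₁f v)ᵀ = -H₁f v) (hH₂t : ∀ v, (H₂f v v)ᵀ = H₂f v v)
    -- (WARD-m) ORDER 0 `a0` DISCHARGED inside ((6) §0: the sym kernel's field block IS the rooted one's; `torus_a0_tower`); the top sym step's order 0 `d0` DISPLAYED (leaf-02 R-20 `QtopSym_mul_smul_tgrad_res`)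
    (d0 : Q₂₀ * Dbar = 0)
    (a1 : ∀ v, H₁f v * W₀ + H₀ * W₁f v = 𝔔₀ᵀ * Y₁f v)
    (a2 : ∀ v, H₂f v v * W₀ + (2 : ℝ) • (H₁f v * W₁f v) + H₀ * W₂f v = -((2 : ℝ) • ((𝔔₁f v)ᵀ * Y₁f v)) + 𝔔₀ᵀ * Y₂f v)
    (c1 : ∀ v, Q₁₁f v * W₀ + Q₁₀ * W₁f v = fromCols (Db₁f v) (0 : Matrix (↥(pbox M') × Fin (d + 1)) (NParam Lc (fine Lc M') (fun k => (fun _ : ℕ => ctrOff (d + 1) Lc) (k + 1)) n) ℝ))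
    (c2 : ∀ v, Q₁₂f v v * W₀ + (2 : ℝ) • (Q₁₁f v * W₁f v) + Q₁₀ * W₂f v = fromCols (Db₂f v) (0 : Matrix (↥(pbox M') × Fin (d + 1)) (NParam Lc (fine Lc M') (fun k => (fun _ : ℕ => ctrOff (d + 1) Lc) (k + 1)) n) ℝ))
    (d1 : ∀ v, Q₂₁f v * Dbar + Q₂₀ * Db₁f v = 0) (d2 : ∀ v, Q₂₂f v v * Dbar + (2 : ℝ) • (Q₂₁f v * Db₁f v) + Q₂₀ * Db₂f v = 0)
    -- right inverses of the three base systems (leaf-05's `kkt_mul_inv_oneShot` ×2 and #41b `kkt_mul_inv_combAt` after the unit, at the record)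
    {XN : Matrix ((↥(pbox (towerTorus Lc M' (n + 1))) × Fin (d + 1)) ⊕ (κ ⊕ (NParam Lc M' (fun _ : ℕ => ctrOff (d + 1) Lc) (n + 1)))) ((↥(pbox (towerTorus Lc M' (n + 1))) × Fin (d + 1)) ⊕ (κ ⊕ (NParam Lc M' (fun _ : ℕ => ctrOff (d + 1) Lc) (n + 1)))) ℝ} (hXN : kkt H₀ (fromRows 𝔔₀ P) * XN = 1)
    {XF : Matrix ((↥(pbox (towerTorus Lc M' (n + 1))) × Fin (d + 1)) ⊕ ((↥(pbox M') × Fin (d + 1)) ⊕ (NParam Lc (fine Lc M') (fun k => (fun _ : ℕ => ctrOff (d + 1) Lc) (k + 1)) n))) ((↥(pbox (towerTorus Lc M' (n + 1))) × Fin (d + 1)) ⊕ ((↥(pbox M') × Fin (d + 1)) ⊕ (NParam Lc (fine Lc M') (fun k => (fun _ : ℕ => ctrOff (d + 1) Lc) (k + 1)) n))) ℝ} (hXF : kkt H₀ (fromRows Q₁₀ τ₁) * XF = 1)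
    {XG : Matrix ((↥(pbox M') × Fin (d + 1)) ⊕ (κ ⊕ (Res (toSite (ctrOff (d + 1) Lc)) Lc M'))) ((↥(pbox M') × Fin (d + 1)) ⊕ (κ ⊕ (Res (toSite (ctrOff (d + 1) Lc)) Lc M'))) ℝ} (hXG : kkt S.toBlocks₁₁ (fromRows Q₂₀ τ₂) * XG = 1)
    -- a finite family of directions, a pair
    {σ : Type*} [Fintype σ] [DecidableEq σ] (dv : σ → V) (k l : σ) :
    hessT (XN.submatrix (Sum.map id Sum.inl) (Sum.map id Sum.inl))
        (fromBlocks (H'₁f (dv k)) (-(𝔔'₁f (dv k))ᵀ) (𝔔'₁f (dv k)) 0) (fromBlocks (H'₁f (dv l)) (-(𝔔'₁f (dv l))ᵀ) (𝔔'₁f (dv l)) 0)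
        (kkt ((1 / 2 : ℝ) • (H'₂f (dv k) (dv l) + H'₂f (dv l) (dv k))) ((1 / 2 : ℝ) • (𝔔'₂f (dv k) (dv l) + 𝔔'₂f (dv l) (dv k))))
      = hessT (XF.submatrix (Sum.map id Sum.inl) (Sum.map id Sum.inl))
          (fromBlocks (H₁f (dv k)) (-(Q₁₁f (dv k))ᵀ) (Q₁₁f (dv k)) 0) (fromBlocks (H₁f (dv l)) (-(Q₁₁f (dv l))ᵀ) (Q₁₁f (dv l)) 0)
          (kkt ((1 / 2 : ℝ) • (H₂f (dv k) (dv l) + H₂f (dv l) (dv k))) ((1 / 2 : ℝ) • (Q₁₂f (dv k) (dv l) + Q₁₂f (dv l) (dv k))))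
        + hessT (XG.submatrix (Sum.map id Sum.inl) (Sum.map id Sum.inl))
          (fromBlocks (Gw₁f (dv k)) (-(Q₂₁f (dv k))ᵀ) (Q₂₁f (dv k)) 0) (fromBlocks (Gw₁f (dv l)) (-(Q₂₁f (dv l))ᵀ) (Q₂₁f (dv l)) 0)
          (kkt ((1 / 2 : ℝ) • (Gw₂f (dv k) (dv l) + Gw₂f (dv l) (dv k))) ((1 / 2 : ℝ) • (Q₂₂f (dv k) (dv l) + Q₂₂f (dv l) (dv k)))) := by
  exact hessT_kernel_law_tower_G M' Lc lev (fun _ : ℕ => ctrOff (d + 1) Lc) n (QSym Lc)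
    (fun ℓ _ => bhKStepSh d Lc (Dsh Lc) ℓ) hrs hlev hM' (hH₀ := hH₀) (hQ₁₀ := hQ₁₀) (hτ₁ := hτ₁)
    (hH₀t := by
      rw [hH₀]
      exact torus_H₀_transpose_comb (towerTorus Lc M' (n + 1)) (dvd_towerTorus_succ (Lc := Lc) M' n) (lev (n + 1)))
    (hone := fun k T _ => torus_h1_comb T (lev k))
    (hId := fun k T _ _ => hId_comb T (lev k))
    (Q₂₀ := Q₂₀)
    (htop := by
      rw [hQ₂₀, hτ₂]
      exact (torus_isUnit_det_kkt_combRows_comb M' hM' (lev 0) _ hfμ' (fun a => ⟨mμ' a, rfl⟩) hcoarse').ne_zero)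
    (a0 := by
      have hH₀' : H₀ = (perF (towerTorus Lc M' (n + 1)) (bhKStepAt d (toSite (ctrOff (d + 1) Lc)) Lc (lev (n + 1)))).submatrix
          (fun b : ↥(pbox (towerTorus Lc M' (n + 1))) × Fin (d + 1) => ((b.1, Sum.inl b.2) : Idx (towerTorus Lc M' (n + 1)) (Fib d)))
          (fun b : ↥(pbox (towerTorus Lc M' (n + 1))) × Fin (d + 1) => ((b.1, Sum.inl b.2) : Idx (towerTorus Lc M' (n + 1)) (Fib d))) := by
        rw [hH₀]; ext p q
        simp only [Matrix.submatrix_apply, perF_apply, perZ_apply]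
        exact tsum_congr fun m => bhKStepSh_Dsh_inl_inl_eq_bhKStepAt Lc (toSite (ctrOff (d + 1) Lc)) (lev (n + 1)) _ _ _ _
      exact torus_a0_tower Lc M' lev (fun _ : ℕ => ctrOff (d + 1) Lc) n hrs hH₀' hW₀)
    (hSL := hSL) (hτ₂ := hτ₂) (hW₀ := hW₀) (hP := hP) (c := c) (hDbar := hDbar) (c0 := c0) (hTW := hTW) (hΓ := hΓ) (hI := hI) (hL := hL) (hS := hS)
    (h𝔔₀ := h𝔔₀) (hv := hv) (lv := lv) (hlv := hlv) (Xbf := Xbf) (hXbf := hXbf) (H₁f := H₁f) (hH₁l := hH₁l) (Q₁₁f := Q₁₁f) (hQ₁₁l := hQ₁₁l)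
    (Q₂₁f := Q₂₁f) (hQ₂₁l := hQ₂₁l) (H₂f := H₂f) (hH₂l := hH₂l) (hH₂r := hH₂r) (Q₁₂f := Q₁₂f) (hQ₁₂l := hQ₁₂l) (hQ₁₂r := hQ₁₂r) (Q₂₂f := Q₂₂f)
    (hQ₂₂l := hQ₂₂l) (hQ₂₂r := hQ₂₂r) (𝔔₁f := 𝔔₁f) (h𝔔₁ := h𝔔₁) (𝔔₂f := 𝔔₂f) (h𝔔₂ := h𝔔₂) (H'₁f := H'₁f) (hH'₁f := hH'₁f) (H'₂f := H'₂f)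
    (hH'₂f := hH'₂f) (𝔔'₁f := 𝔔'₁f) (h𝔔'₁f := h𝔔'₁f) (𝔔'₂f := 𝔔'₂f) (h𝔔'₂f := h𝔔'₂f) (W₁f := W₁f) (W₂f := W₂f) (hW₁f := hW₁f) (hW₂f := hW₂f)
    (Db₁f := Db₁f) (Db₂f := Db₂f) (Y₁f := Y₁f) (Y₂f := Y₂f) (Gw₁f := Gw₁f) (hGw₁f := hGw₁f) (Gw₂f := Gw₂f) (hGw₂f := hGw₂f) (uTop := uTop)
    (hH₁t := hH₁t) (hH₂t := hH₂t) (d0 := d0) (a1 := a1) (a2 := a2) (c1 := c1) (c2 := c2) (d1 := d1) (d2 := d2) (hXN := hXN) (hXF := hXF) (hXG := hXG)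
    (dv := dv) (k := k) (l := l)

end TowerSym

end Summit.QuantumFields.BalabanUV.Beta.FP.NestedDoorSocketTowerSymB

end
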